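import Summits.NavierStokesRegularity.NavierStokesRegularity.Theorems.UnthreadedDoorCellFluxClusterFluxNearCentreCap
import Summits.NavierStokesRegularity.NavierStokesRegularity.Theorems.UnthreadedDoorCellFluxClusterFluxLeVorticity
import HarnessLib

/-!
# Σ-0bR₁ `ClusterFluxNearCentreCap` holds unconditionally (crux idea «cell-flux» / «indicatrix-bound» on crux `PoloidalLiouville`,
# stmt-NavierStokesRegularity-1222)

Support file for crux `PoloidalLiouville` (wall W1; crux ideas of planner ns-idea-14: `Cruxes/PoloidalLiouville/CellFluxSketch.lean`
Σ-0bR₁ and `Cruxes/PoloidalLiouville/IndicatrixSketch.lean` l.804 `stub_clusterFluxNearCentreCap`).  Experiment cell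
`pub/ns-wall-extremal` (req171), seat ns-wall-eng-4 g8, the one row named by exp-lead g2 under director-ns g19 p117.  Theorems only;
no definitions, no named facts; nothing here proves `PoloidalLiouville`, `stub_scalarLiouville` or Navier–Stokes regularity.

CONTENT (modus ponens on two accepted theorems of the tree, so that citing files can use the Prop BY NAME without a hypothesis
and without importing a crux workfile):
* `clusterFluxNearCentreCap_holds : ClusterFluxNearCentreCap` — the Theorems-side twin Prop of Σ-0bR₁
  (`UnthreadedDoorCellFluxClusterFluxNearCentreCap.lean`, p718757, ARM A g7: `clusterFluxNearCentreCap_of :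
  ClusterFluxLeVorticity → ClusterFluxNearCentreCap`) fed with Σ-0a `clusterFluxLeVorticity : ClusterFluxLeVorticity`
  (`UnthreadedDoorCellFluxClusterFluxLeVorticity.lean`, p717414, ns-qj-p1 g7).
* `clusterFlux_nearCentre_cap'` — the explicit near-centre GROWTH CAP of p718757 (`clusterFlux_nearCentre_cap`: for `v` smooth on
  the window, `T` smooth off the centre, `curl v(t) = ∇T(t) × (x − x₀)`, a dense cell-count bound `≤ N₀` on `[t₁,t₂] × ]0,1[` and an
  admissible rule `𝒞`, there is `κ ≥ 0` with `clusterFlux (T t) a (𝒞 t a) ≤ κ a²`; `κ = N₀ π L`) with its Σ-0a hypothesis discharged.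

HONEST LABEL: information-grade support strictly below ⟨1222⟩; W1 movement 0; NS regularity NOT proved.

## References
* planner ns-idea-14, `Cruxes/PoloidalLiouville/CellFluxSketch.lean` (Σ-0a, Σ-0bR₁) and `IndicatrixSketch.lean` v1.7.3 (l.804);
  `pub/ns-wall-extremal/STATUS.md` (ARM A g7 12:24:41Z wiring; exp-lead g2 15:00:42Z named row).
* G. Koch, N. Nadirashvili, G. Seregin, V. Šverák, Acta Math. 203 (2009) 83–105 (the Type-I ancient-solution frame of the line).
  [KochNadirashviliSereginSverak2009]
-/

-- the summit and its single problem share the name (D-0017 nested layout)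
set_option linter.dupNamespace false

noncomputable section

namespace Summit.NavierStokesRegularity.NavierStokesRegularity.Theorems.PoloidalLiouville.CellFlux

open Set Function Filter Topology MeasureTheory
open scoped RealInnerProductSpace
open Summit.NavierStokesRegularity.NavierStokesRegularity.Theorems.PoloidalLiouville.NetFlux (E3)
open Literature.Analysis Literature.Analysis.FluidPDE

/-- ★ **Σ-0bR₁ holds**: `ClusterFluxNearCentreCap` (near-centre quadratic growth cap of the cluster flux of an admissible rule,
under NF-6's binder block and a dense cell-count bound) is TRUE in the tree BY NAME — `clusterFluxNearCentreCap_of` (p718757) fed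
with Σ-0a `clusterFluxLeVorticity` (p717414).  The sketches' `stub_clusterFluxNearCentreCap` closes by the same term. [folklore] -/
theorem clusterFluxNearCentreCap_holds : ClusterFluxNearCentreCap :=
  clusterFluxNearCentreCap_of clusterFluxLeVorticity

/-- ★ **The explicit near-centre growth cap, Σ-0a discharged** (`clusterFlux_nearCentre_cap` of p718757 with its hypothesis
`ClusterFluxLeVorticity` supplied by the landed `clusterFluxLeVorticity`): for `v` smooth on `]t₀,0[ × ℝ³`, `T` smooth off the
centre with `curl v(t) = ∇T(t) × (x − x₀)` on the window, `t₀ < t₁ ≤ t₂ < 0`, a dense set of `(t,a) ∈ [t₁,t₂] × ]0,1[` with at most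
`N₀` cells on `S_a(x₀)` for `T(t)`, and an admissible rule `𝒞`, there is `κ ≥ 0` with `clusterFlux (T t) a (𝒞 t a) ≤ κ a²` for all
`t ∈ [t₁,t₂]`, `a ∈ ]0,1[`. [folklore] -/
theorem clusterFlux_nearCentre_cap' (v : ℝ → E3 → E3) (x₀ : E3) (T P : ℝ → E3 → ℝ)
    (V : ℝ → ℝ) (t₀ t₁ t₂ : ℝ) (h01 : t₀ < t₁) (h12 : t₁ ≤ t₂) (h20 : t₂ < 0)
    (hv : ContDiffOn ℝ (⊤ : ℕ∞) (uncurry v) (Ioo t₀ 0 ×ˢ (univ : Set E3)))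
    (hT : ContDiffOn ℝ (⊤ : ℕ∞) (uncurry T) (Ioo t₀ 0 ×ˢ ({x₀}ᶜ : Set E3)))
    (hlink : ∀ t ∈ Ioo t₀ 0, ∀ x, curl (v t) x = cross (gradient (T t) x) (x - x₀))
    (N₀ : ℕ)
    (hdense : Icc t₁ t₂ ×ˢ Ioo (0 : ℝ) 1 ⊆
      closure {p : ℝ × ℝ | p.1 ∈ Ioo t₀ 0 ∧ 0 < p.2 ∧ (cellSet (T p.1) x₀ p.2).Finite ∧
        (cellSet (T p.1) x₀ p.2).ncard ≤ N₀})
    (𝒞 : ℝ → ℝ → Set (Set E3)) (h𝒞 : AdmissibleRule x₀ T P V t₀ 𝒞) :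
    ∃ κ : ℝ, 0 ≤ κ ∧ ∀ t ∈ Icc t₁ t₂, ∀ a ∈ Ioo (0 : ℝ) 1,
      clusterFlux (T t) a (𝒞 t a) ≤ κ * a ^ 2 :=
  clusterFlux_nearCentre_cap clusterFluxLeVorticity v x₀ T P V t₀ t₁ t₂ h01 h12 h20 hv hT hlink N₀ hdense 𝒞 h𝒞

end Summit.NavierStokesRegularity.NavierStokesRegularity.Theorems.PoloidalLiouville.CellFlux

end
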